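import Summits.ResolutionOfSingularities.ResolutionOfSingularities.Theorems.EquisingularLiftEquisingularLiftNatSubchainPointResolutionOff
import Summits.ResolutionOfSingularities.ResolutionOfSingularities.Theorems.EquisingularLiftEquisingularLiftNatSubchainSupplierInvSLDefs
import Summits.ResolutionOfSingularities.ResolutionOfSingularities.Theorems.EquisingularLiftEquisingularLiftNatDirZeroDefs
import Literature.AlgebraicGeometry.HodgeTheory.NormalSheafAffineSections
import HarnessLib

/-!
# [OURS · L1 W4.5(b) · EL♮ / EL♮(3) · WIDTH TABLE D8 «NODAL HOSTED ROUND (HR-KEEP-N)», supplier row] THE NAMED SUPPORT DEBT S-D8-LIFT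
# `NodalHostedRoundFact` = the HROUND-KEEP-N supplier binder of the K5⁸ engine `target_elnat_of_letteredPrefixResolution8` at `n := 3`, as ONE named `Prop`

PEN: res-type-027 g22 (desk R69 (iii): D8 typing; «the NEW UPSTAIRS SUPPLIER … is a CONJUNCT … = supplier DEBT exactly like today's (HR-KEEP) lift debt — NOT a
registration gate; booked as support debt S-D8-LIFT»).  OURS; a NAMED HYPOTHESIS, not a statement of any manuscript; nothing of [Hironaka2017] asserted; AI-written,
weaker than expert review; resolution of singularities in positive characteristic is NOT proved here, EL♮(3) is NOT proved here.  Definition lane;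
`--supports stmt-ResolutionOfSingularities-20148 --as helper`.

WHAT.  `NodalHostedRoundFact : Prop` := «for every algebraically closed field `k`: ✓ `TCPlus.hround_keep k _`'s STATEMENT (…NatHostedRoundKeep ll.92–137, p682536)
with its binder «`∀ z : Z̃, IsRegularLocalRing (stalk z)`» REPLACED by (N1) `Set.Finite {z : Z̃ | ¬ IsRegularLocalRing (stalk z)}` and the binder (N4) «a global section
`ψ ∈ Γ(Z̃, 𝒩_{Z̃/Ẽ₁})` that is a unit at every non-regular closed point of `Z̃`» (Defs10's bytes) INSERTED right after `DirStepUnobs …`; conclusion UNCHANGED (the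
upstairs package after the round: new model square, every listed letter's strict transform carries a `TCPlus.LetterDatum`, the exceptional letter `υ'⁻¹ Z` is born)»
— i.e. LITERALLY the HROUND-KEEP-N binder of ✓/⊙ K5⁸ `target_elnat_of_letteredPrefixResolution8` at `n := 3`, so that RUNG⁸ `nd_leaves_rung_threeP8` can take it BY
NAME as its one new hypothesis (`EmbeddedCurveLiftFact → NodalHostedRoundFact → p.Prime → …`), exactly as RUNG⁷ takes F-88 `EmbeddedCurveLiftFact`.
WHY A NAMED FACT (by the bytes).  ✓ `TCPlus.hround_keep k hF` discharges K5⁷'s HROUND-KEEP from F-88 `hF : EmbeddedCurveLiftFact`, whose `EmbeddedCurveLiftAt` carries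
the binder «`Z̃` regular» (…NatTowerRoundFourDefs l.169); for a NODAL `Z̃` no tree theorem supplies the package yet.  By the bytes of ✓ `hround_keep`'s proof the
regularity of `Z̃` is read in exactly two places: the lift (T-k) and the (CL) bridge ✓ `crossing_stalkwise_of_curve_trace` (at the crossing points `Z ∩ cl L` only).
The DISCHARGE `theorem nodalHostedRoundFact_holds : NodalHostedRoundFact` (support debt S-D8-LIFT, res-L1-w45b-stub-4's pre-study) = `hround_keep`'s composition
(HT2′ host transport, (CL) members, (EB₀) birth) over (i) a NODAL LIFT FACT «F-88 with «`Z̃` regular» ↦ (N1) + (N4)» (formal lifts to all orders from `DirStepUnobs`,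
algebraisation over the complete `O`, regular total space at the nodes from (N4): first-order direction `ψ` with `ψ(z) ≠ 0` ⇒ local equation `f + ϖg`, `g(z) ≠ 0`)
and (ii) a POINTWISE (CL) bridge at the non-regular crossing points ((T1)/(T2) there follow from the members block by isolatedness: a member through a node containing
no branch meets `Z` in an isolated point; a member containing a branch contains the whole component and violates the no-branch clause at a nearby regular closed
point, which exists by (N1)).  Customer of record: Q47 (lead-1 FORCED-MULTISECTION-Q47 memo), whose centre `𝒵 = V(ỹ, d + ϖd′)` is regular, `O`-flat, with reduced
nodal trace Γ₀.
-/

set_option linter.dupNamespace false -- mandated namespace `Summit.<Summit>.<Problem>` of this single-conjunct summit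
set_option linter.overlappingInstances false -- the statement carries `[IsDomain O] [IsDiscreteValuationRing O]`

noncomputable section

open CategoryTheory CategoryTheory.Limits AlgebraicGeometry TopologicalSpace Topology IsLocalRing
open Literature.AlgebraicGeometry.Resolution
open AlgebraicGeometry.Scheme.IdealSheafData
open Summit.ResolutionOfSingularities.ResolutionOfSingularities.Theses.EquisingularLift.Split
open Summit.ResolutionOfSingularities.ResolutionOfSingularities.Cruxes.EquisingularLift.StrataSplit

namespace Summit.ResolutionOfSingularities.ResolutionOfSingularities.Cruxes.EquisingularLiftNat.Sections

/-- **S-D8-LIFT as a named fact: `NodalHostedRoundFact`** — for every algebraically closed `k`, the HROUND-KEEP-N supplier statement of the K5⁸ engine at `n := 3`: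
✓ `TCPlus.hround_keep`'s statement with «`Z̃` regular» replaced by (N1) «finitely many non-regular points» and (N4) «a global normal section of `Z̃ ⊂ Ẽ₁` that is a
unit at every non-regular closed point» inserted after `DirStepUnobs`; conclusion unchanged (new model square; every listed letter's strict transform carries a
`TCPlus.LetterDatum`; the exceptional letter `υ'⁻¹ Z` is born).  Consumed ONLY as a hypothesis (RUNG⁸); its discharge is the support debt S-D8-LIFT.
[OURS · L1 W4.5b · WIDTH TABLE D8 · named hypothesis, no mathematical content of its own] -/
def NodalHostedRoundFact : Prop :=
  ∀ (k : Type) [Field k] [IsAlgClosed k],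
    ∀ (O : Type) [CommRing O] [IsDomain O] [IsDiscreteValuationRing O] [IsAdicComplete (IsLocalRing.maximalIdeal O) O]
        [IsAlgClosed (IsLocalRing.ResidueField O)] (θ : O →+* k), Function.Surjective θ →
      ∀ (P : AlgebraicGeometry.Scheme.{0}) (q : P ⟶ AlgebraicGeometry.Spec (.of O)) (Y : Set P)
        (Ch : ∀ X' : AlgebraicGeometry.Scheme.{0}, (X' ⟶ P) → Set X' → Prop),
        (∀ (X' X'' : AlgebraicGeometry.Scheme.{0}) (σ' : X' ⟶ P) (S' : Set X') (C : X'.IdealSheafData) (τ : X'' ⟶ X'),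
          Ch X' σ' S' → Literature.AlgebraicGeometry.Resolution.IsBlowup τ C →
          Literature.AlgebraicGeometry.Resolution.Scheme.IsRegular C.subscheme → AlgebraicGeometry.Flat (C.subschemeι ≫ σ' ≫ q) →
          σ' '' (C.support : Set X') ⊆ {y | ¬ IsGenericPoint y Y} →
          (C.support : Set X') ∩ (σ' ≫ q) ⁻¹' {IsLocalRing.closedPoint O} ⊆ S' →
          Ch X'' (τ ≫ σ') (closure (τ ⁻¹' (S' \ (C.support : Set X'))))) →
        (∀ (X' : AlgebraicGeometry.Scheme.{0}) (σ' : X' ⟶ P) (S' : Set X'), Ch X' σ' S' →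
          Summit.ResolutionOfSingularities.ResolutionOfSingularities.Theses.EquisingularLift.Split.Chain P Y X' σ' S') →
        Y ⊆ q ⁻¹' {IsLocalRing.closedPoint O} → IsIrreducible Y → IsClosed Y →
        AlgebraicGeometry.IsIntegral P → IsLocallyNoetherian P → Literature.AlgebraicGeometry.Resolution.Scheme.IsRegular P →
        AlgebraicGeometry.IsProper q → AlgebraicGeometry.SmoothOfRelativeDimension 3 q →
      ∀ (X' : AlgebraicGeometry.Scheme.{0}) (σ' : X' ⟶ P) (S' : Set X'), Ch X' σ' S' → AlgebraicGeometry.IsIntegral X' →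
        IsLocallyNoetherian X' → Literature.AlgebraicGeometry.Resolution.Scheme.IsRegular X' →
        AlgebraicGeometry.IsDominant (σ' ≫ q) →
      ∀ (F₁ : AlgebraicGeometry.Scheme.{0}), AlgebraicGeometry.IsIntegral F₁ → ∀ (j : F₁ ⟶ X')
        (t : F₁ ⟶ AlgebraicGeometry.Spec (.of k)),
        IsPullback j t (σ' ≫ q) (AlgebraicGeometry.Spec.map (CommRingCat.ofHom θ)) →
      ∀ (T₁ : Set F₁), IsClosed T₁ → IsIrreducible T₁ → j '' T₁ = S' →
      ∀ (Ls : List (Set F₁)), (∀ L ∈ Ls, TCPlus.LetterDatum O P q Y F₁ X' σ' j L) →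
      ∀ (E₁ : Set F₁) (Z : Set F₁) (hZ : IsClosed Z) (F₃ : AlgebraicGeometry.Scheme.{0}) (υ' : F₃ ⟶ F₁),
        E₁ ∈ Ls → Z ⊆ closure E₁ → Z ⊆ T₁ → ¬ T₁ ⊆ Z →
        Set.Finite {z : ↥(redSub F₁ Z hZ) | ¬ IsRegularLocalRing ((redSub F₁ Z hZ).presheaf.stalk z)} →
        (∀ (i : redSub F₁ Z hZ ⟶ redSub F₁ (closure E₁) isClosed_closure), i ≫ redSubι F₁ (closure E₁) isClosed_closure = redSubι F₁ Z hZ →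
          ∀ z : ↥(redSub F₁ Z hZ), IsRegularLocalRing ((redSub F₁ (closure E₁) isClosed_closure).presheaf.stalk (i z))) →
        DirStepUnobs F₁ (closure E₁) isClosed_closure Z hZ →
        (∀ (i : redSub F₁ Z hZ ⟶ redSub F₁ (closure E₁) isClosed_closure), i ≫ redSubι F₁ (closure E₁) isClosed_closure = redSubι F₁ Z hZ →
          ∃ ψ : Γ(Literature.AlgebraicGeometry.HodgeTheory.normalSheaf i, ⊤),
            ∀ z : ↥(redSub F₁ Z hZ), IsClosed ({z} : Set ↥(redSub F₁ Z hZ)) → ¬ IsRegularLocalRing ((redSub F₁ Z hZ).presheaf.stalk z) →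
              ∃ (U : (redSub F₁ (closure E₁) isClosed_closure).affineOpens) (hz : z ∈ i ⁻¹ᵁ (U : (redSub F₁ (closure E₁) isClosed_closure).Opens))
                (m : Γ(Literature.AlgebraicGeometry.Deformation.idealModule i, (U : (redSub F₁ (closure E₁) isClosed_closure).Opens))),
                IsUnit ((redSub F₁ Z hZ).presheaf.germ (i ⁻¹ᵁ (U : (redSub F₁ (closure E₁) isClosed_closure).Opens)) z hz
                  (Literature.AlgebraicGeometry.HodgeTheory.normalSectionsVal i U
                    (Literature.AlgebraicGeometry.HodgeTheory.normalSheafSectionsEquiv i _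
                      ((Literature.AlgebraicGeometry.HodgeTheory.normalSheaf i).presheaf.map (homOfLE le_top).op ψ)) m))) →
        (∀ z : ↥(redSub F₁ Z hZ), IsClosed ({z} : Set ↥(redSub F₁ Z hZ)) → ringKrullDim ((redSub F₁ Z hZ).presheaf.stalk z) = ((1 : ℕ) : WithBot ℕ∞)) →
        -- the pair clause's «other members» block: every listed `L ≠ E₁` does not contain `Z` and meets it transversally (possibly not at all)
        (∀ L ∈ Ls, L ≠ E₁ →
          AlgebraicGeometry.Scheme.IdealSheafData.vanishingIdeal (⟨closure L, isClosed_closure⟩ : TopologicalSpace.Closeds F₁) ⊔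
              AlgebraicGeometry.Scheme.IdealSheafData.vanishingIdeal (⟨Z, hZ⟩ : TopologicalSpace.Closeds F₁) =
            AlgebraicGeometry.Scheme.IdealSheafData.vanishingIdeal (⟨closure L ∩ Z, isClosed_closure.inter hZ⟩ : TopologicalSpace.Closeds F₁) ∧
          ∀ z ∈ Z, IsClosed ({z} : Set F₁) →
            ¬ Literature.AlgebraicGeometry.Resolution.stalkIdeal (AlgebraicGeometry.Scheme.IdealSheafData.vanishingIdeal (⟨closure L, isClosed_closure⟩ : TopologicalSpace.Closeds F₁)) z ≤
              Literature.AlgebraicGeometry.Resolution.stalkIdeal (AlgebraicGeometry.Scheme.IdealSheafData.vanishingIdeal (⟨Z, hZ⟩ : TopologicalSpace.Closeds F₁)) z) →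
        Literature.AlgebraicGeometry.Resolution.IsBlowup υ' (AlgebraicGeometry.Scheme.IdealSheafData.vanishingIdeal (⟨Z, hZ⟩ : TopologicalSpace.Closeds F₁)) →
        ∃ (X₉ : AlgebraicGeometry.Scheme.{0}) (σ₉ : X₉ ⟶ P) (S₉ : Set X₉) (j₉ : F₃ ⟶ X₉) (t₉ : F₃ ⟶ AlgebraicGeometry.Spec (.of k)),
          Ch X₉ σ₉ S₉ ∧ AlgebraicGeometry.IsIntegral X₉ ∧ IsLocallyNoetherian X₉ ∧
          Literature.AlgebraicGeometry.Resolution.Scheme.IsRegular X₉ ∧ AlgebraicGeometry.IsDominant (σ₉ ≫ q) ∧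
          IsPullback j₉ t₉ (σ₉ ≫ q) (AlgebraicGeometry.Spec.map (CommRingCat.ofHom θ)) ∧ j₉ '' (closure (υ' ⁻¹' (T₁ \ Z))) = S₉ ∧
          IsClosed (closure (υ' ⁻¹' (T₁ \ Z))) ∧ IsIrreducible (closure (υ' ⁻¹' (T₁ \ Z))) ∧ AlgebraicGeometry.IsIntegral F₃ ∧
          (∀ L ∈ Ls, TCPlus.LetterDatum O P q Y F₃ X₉ σ₉ j₉ (closure (υ' ⁻¹' (closure L \ Z)))) ∧
          TCPlus.LetterDatum O P q Y F₃ X₉ σ₉ j₉ (υ' ⁻¹' Z)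

end Summit.ResolutionOfSingularities.ResolutionOfSingularities.Cruxes.EquisingularLiftNat.Sections

end
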